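import Literature.Analysis.FluidPDE.TorusTransversalModesHeatFlow
import HarnessLib

/-!
# Barrier: the SHAPE of a Fourier shell is FROZEN along the exact heat-flow solutions of
# Navier–Stokes on `𝕋ᵈ` — no universal dephasing / decoherence / equipartition law inside a shell
# holds along all solutions; the dynamics adds nothing to the static bound on transversal data

Barrier catalogue entry for `NavierStokesRegularity` (D-0021), METHOD LEVEL, everything PROVED
(zero fact debt). Degree-ZERO companion of `ExactModeLineDecayLaws` (which audits functionals that
are homogeneous of POSITIVE degree along the single Stokes-mode line: decay laws, floors, envelopes)
and of `CesaroSpectrumNoSupControl` (time-AVERAGED statistics); `ParallelShearSlot` is the POINTWISE half of the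
same witness family (gap seed G2, W4/W5 of the cell's COUNTERMODEL-INDEX §6: identities among the point
values of `u, ∂ₜu, (u·∇)u, Δu, ∇p` on `ℝ³`), this entry its FOURIER-SHAPE / in-shell-statistics half
on `𝕋ᵈ`, with many modes per shell and free phases.

THE WITNESS FAMILY (tree `Literature.Analysis.FluidPDE.TransversalModes`, file
`TorusTransversalModesHeatFlow.lean`). For a finite frequency set `S ⊂ ℤᵈ` and coefficients `c k ∈ ℂᵈ` that are
CROSS-TRANSVERSAL — `l · c k = 0` for all `k, l ∈ S` (parallel shear flows: all `l` on one axis,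
`c k` normal to it; 2½-dimensional columnar flows: all `l` horizontal, `c k` vertical; …) — the heat
flow `U(t) = Re Σ_{k∈S} e^{−4π²ν|k|²t} e^{2πik·x} c k` of the real trigonometric polynomial
`realTrigPoly S c` has `(U·∇)U = 0` and `div U = 0`, hence is an exact classical solution of the
unforced Navier–Stokes system on `ℝ × 𝕋ᵈ` with zero pressure, for EVERY `ν` (Majda–Bertozzi 2002
§1.2 / Acheson 1990 §2.3: parallel shear flows reduce Navier–Stokes to the heat equation;
Pizzocchero 2021 §6 (6.3), (6.6) for the single mode). `isClassicalNSSolutionOn_heatFlow`,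
`isGlobalLerayHopf_heatFlow`; the phases and amplitudes `c k` are FREE.

THE FROZEN SHAPE (§1). The Fourier coefficient of `U(t)` at `k` is `e^{−4π²ν|k|²t}` times that of
`U(0)` (`coeffs_heatFlow`): on each shell `{|k|² = K}` the whole coefficient vector is
multiplied by ONE positive real number. Hence every functional `Φ` of the coefficients that
(i) depends only on the coefficients on the shell `K` and (ii) is invariant under multiplication by a
positive real (degree `0`: phase-coherence / «magnetisation» order parameters, normalised sectoral or
helical energy RATIOS inside the shell, participation numbers, alignment statistics) is a CONSTANT OF
MOTION along `U`: `Φ(Û(t)) = Φ(Û(0))` (`shellShape_heatFlow_eq`).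

THE BARRIER (§2). Consequently a law of the form «for every (classical / Leray–Hopf) solution,
`Φ(û(t)) ≤ C` for all `t ≥ τ(u(0))`» — dephasing after a relaxation time, «χ_K → O(1) regardless of
the initial phase configuration», equipartition / isotropisation inside a shell — already forces
`Φ(ŵ) ≤ C` for EVERY cross-transversal trigonometric datum `w` (`static_bound_of_relaxation_law`):
the relaxation time is idle and the only universal bound is the static one, which transversal data
with aligned phases typically violate (cell `ns-claims`, row C135 `Literature.Claims.NS.Siche2026`:
`Step2_dephasing` Prop 5.9 (31) p.10, `Step3_contraction` Lemma 6.7 p.14, `Step4_globalDecoherence`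
Thm 6.28 (51) p.22 — all kernel-false on frozen-phase shear heat flows, `…Theorems.Siche2026.not_Step2_dephasing`
/ `not_Step3_contraction` p507325, `not_Step4_globalDecoherence` p508594, where the shell coherence
`χ_K ≤ N_K` is attained and `N_K` is unbounded). Likewise a strict-contraction law «`Φ(û(t+τ)) < Φ(û(t))`
whenever `Φ(û(t)) > R`» forces `Φ(ŵ) ≤ R` on the witness data (`threshold_ge_of_contraction_law`).

## References

* A. J. Majda, A. L. Bertozzi, *Vorticity and Incompressible Flow*, CUP 2002, §1.2 (exact shear-flow
  solutions). [`MajdaBertozzi2002`]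
* D. J. Acheson, *Elementary Fluid Dynamics*, OUP 1990, §2.3 (2.8)–(2.9). [`Acheson1990`]
* L. Pizzocchero, *On the global stability of smooth solutions of the Navier–Stokes equations*,
  Appl. Math. Lett. 115 (2021), §6 (6.3), (6.6). [`Pizzocchero2021`]
* L. Grafakos, *Classical Fourier Analysis*, 3rd ed. 2014, §3.1.1 (Fourier coefficients on `𝕋ᵈ`). [`Grafakos2014`]

WHAT THIS IS NOT: not a claim about NS regularity or blow-up; not a claim about any author beyond the
typed locator.
-/

set_option linter.dupNamespace false

noncomputable section

open Set Function MeasureTheory UnitAddTorus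
open scoped ContDiff RealInnerProductSpace InnerProductSpace ComplexConjugate

namespace Literature.Barriers.NavierStokesRegularity

namespace FrozenShellShape

open Literature.Analysis.FunctionSpaces Literature.Analysis.FunctionSpaces.Torus
  Literature.Analysis.FluidPDE Literature.Analysis.FluidPDE.TransversalModes

variable {d : Type*} [Fintype d]

/-! ## §1 The frozen shape: on each Fourier shell the heat flow acts by one positive scalar -/

variable [DecidableEq d]

/-- The Fourier coefficients of a field on `𝕋ᵈ` (complexified). [cite: Grafakos2014, §3.1.1] -/
def coeffs (w : UnitAddTorus d → EuclideanSpace ℝ d) (k : d → ℤ) : EuclideanSpace ℂ d :=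
  mFourierCoeff (EuclideanSpace.complexify ∘ w) k

/-- **Fourier coefficients of the heat flow**: `Û(t)(k) = e^{−λ_k t} Û(0)(k)` for every `k`.
[cite: Grafakos2014, §3.1.1] -/
theorem coeffs_heatFlow (ν : ℝ) (S : Finset (d → ℤ)) (c : (d → ℤ) → EuclideanSpace ℂ d) (t : ℝ)
    (k : d → ℤ) :
    coeffs (heatFlow ν S c t) k = ((Real.exp (-(rate ν k * t)) : ℝ) : ℂ) • coeffs (realTrigPoly S c) k := by
  unfold coeffs heatFlow
  rw [mFourierCoeff_realTrigPoly_eq, mFourierCoeff_realTrigPoly_eq]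
  have h1 : (if k ∈ S then heatCoeff ν c t k else 0) =
      ((Real.exp (-(rate ν k * t)) : ℝ) : ℂ) • (if k ∈ S then c k else 0) := by
    split_ifs
    · rfl
    · rw [smul_zero]
  have h2 : EuclideanSpace.conjVec (if -k ∈ S then heatCoeff ν c t (-k) else 0) =
      ((Real.exp (-(rate ν k * t)) : ℝ) : ℂ) • EuclideanSpace.conjVec (if -k ∈ S then c (-k) else 0) := by
    split_ifs
    · rw [heatCoeff, rate_neg, EuclideanSpace.conjVec_smul, Complex.conj_ofReal]
    · simp
  rw [h1, h2, ← smul_add, smul_comm]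

variable {α : Sort*}

/-- **FROZEN SHELL SHAPE.** Let `Φ` be a functional of Fourier coefficient data which (i) depends only
on the coefficients on the shell `{k : |k|² = K}` and (ii) is invariant under multiplication of the data
by a positive real number (degree `0`). Then `Φ` is constant along the heat flow of every real
trigonometric polynomial: `Φ(Û(t)) = Φ(Û(0))`. [cite: Grafakos2014, §3.1.1] -/
theorem shellShape_heatFlow_eq {Φ : ((d → ℤ) → EuclideanSpace ℂ d) → α} {K : ℝ}
    (hdep : ∀ a b : (d → ℤ) → EuclideanSpace ℂ d, (∀ k, freqNormSq k = K → a k = b k) → Φ a = Φ b)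
    (hhom : ∀ r : ℝ, 0 < r → ∀ a : (d → ℤ) → EuclideanSpace ℂ d, Φ (fun k => ((r : ℝ) : ℂ) • a k) = Φ a)
    (ν : ℝ) (S : Finset (d → ℤ)) (c : (d → ℤ) → EuclideanSpace ℂ d) (t : ℝ) :
    Φ (coeffs (heatFlow ν S c t)) = Φ (coeffs (realTrigPoly S c)) := by
  set r : ℝ := Real.exp (-(4 * Real.pi ^ 2 * ν * K * t)) with hr
  have hK : ∀ k, freqNormSq k = K →
      coeffs (heatFlow ν S c t) k = ((r : ℝ) : ℂ) • coeffs (realTrigPoly S c) k := by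
    intro k hk
    rw [coeffs_heatFlow, rate, hk]
  rw [hdep _ (fun k => ((r : ℝ) : ℂ) • coeffs (realTrigPoly S c) k) hK]
  exact hhom r (Real.exp_pos _) _

/-- Field-level form: a functional `Ψ` of velocity fields that factors through a degree-`0`,
shell-`K`-determined functional of the Fourier coefficients is constant along every heat flow.
[cite: Grafakos2014, §3.1.1] -/
theorem shellShape_heatFlow_eq' {Ψ : (UnitAddTorus d → EuclideanSpace ℝ d) → α}
    {Φ : ((d → ℤ) → EuclideanSpace ℂ d) → α} {K : ℝ} (hΨ : ∀ w, Ψ w = Φ (coeffs w))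
    (hdep : ∀ a b : (d → ℤ) → EuclideanSpace ℂ d, (∀ k, freqNormSq k = K → a k = b k) → Φ a = Φ b)
    (hhom : ∀ r : ℝ, 0 < r → ∀ a : (d → ℤ) → EuclideanSpace ℂ d, Φ (fun k => ((r : ℝ) : ℂ) • a k) = Φ a)
    (ν : ℝ) (S : Finset (d → ℤ)) (c : (d → ℤ) → EuclideanSpace ℂ d) (t : ℝ) :
    Ψ (heatFlow ν S c t) = Ψ (realTrigPoly S c) := by
  rw [hΨ, hΨ]
  exact shellShape_heatFlow_eq hdep hhom ν S c t

/-! ## §2 The barrier theorems: universal relaxation / contraction laws reduce to STATIC bounds on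
transversal data — the dynamics contributes nothing -/

section Barrier

variable {Ψ : (UnitAddTorus d → EuclideanSpace ℝ d) → ℝ} {Φ : ((d → ℤ) → EuclideanSpace ℂ d) → ℝ}
  {K : ℝ}

/-- **NO UNIVERSAL RELAXATION LAW BEYOND THE STATIC BOUND.** If a degree-`0`, shell-`K`-determined
functional `Ψ` obeys «`Ψ(u(t)) ≤ C` for all `t ≥ τ(u(0))`» along EVERY global classical solution of the
unforced Navier–Stokes system on `𝕋ᵈ` with viscosity `ν` (relaxation time `τ` allowed to depend on the
datum), then `Ψ(w) ≤ C` for every cross-transversal trigonometric datum `w = realTrigPoly S c` — the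
value at the datum, before any «dephasing» could act. [cite: MajdaBertozzi2002, §1.2] -/
theorem static_bound_of_relaxation_law (hΨ : ∀ w, Ψ w = Φ (coeffs w))
    (hdep : ∀ a b : (d → ℤ) → EuclideanSpace ℂ d, (∀ k, freqNormSq k = K → a k = b k) → Φ a = Φ b)
    (hhom : ∀ r : ℝ, 0 < r → ∀ a : (d → ℤ) → EuclideanSpace ℂ d, Φ (fun k => ((r : ℝ) : ℂ) • a k) = Φ a)
    {ν C : ℝ} {τ : (UnitAddTorus d → EuclideanSpace ℝ d) → ℝ}
    (hlaw : ∀ (u : ℝ → UnitAddTorus d → EuclideanSpace ℝ d) (p : ℝ → UnitAddTorus d → ℝ),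
      Torus.IsClassicalNSSolutionOn (Ici 0) ν 0 u p → ∀ t : ℝ, τ (u 0) ≤ t → 0 ≤ t → Ψ (u t) ≤ C)
    {S : Finset (d → ℤ)} {c : (d → ℤ) → EuclideanSpace ℂ d}
    (hc : ∀ k ∈ S, ∀ l ∈ S, ∑ j, (l j : ℂ) * c k j = 0) :
    Ψ (realTrigPoly S c) ≤ C := by
  set t : ℝ := max (τ (realTrigPoly S c)) 0 with ht
  have h := hlaw _ _ (isClassicalNSSolutionOn_heatFlow_Ici ν hc) t
    (by rw [heatFlow_zero]; exact le_max_left _ _) (le_max_right _ _)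
  rwa [shellShape_heatFlow_eq' hΨ hdep hhom] at h

/-- **NO UNIVERSAL CONTRACTION ABOVE A THRESHOLD BELOW THE STATIC CEILING.** If «`Ψ(u(t + τ)) < Ψ(u(t))`
whenever `Ψ(u(t)) > R`» holds at every `t ≥ 0` along EVERY global classical solution (`τ = τ(u(0)) > 0` a
datum-dependent turnover time), then `Ψ(w) ≤ R` for every cross-transversal trigonometric datum `w` —
along the witness flow `Ψ` is frozen, so it can never strictly decrease. [cite: MajdaBertozzi2002, §1.2] -/
theorem threshold_ge_of_contraction_law (hΨ : ∀ w, Ψ w = Φ (coeffs w))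
    (hdep : ∀ a b : (d → ℤ) → EuclideanSpace ℂ d, (∀ k, freqNormSq k = K → a k = b k) → Φ a = Φ b)
    (hhom : ∀ r : ℝ, 0 < r → ∀ a : (d → ℤ) → EuclideanSpace ℂ d, Φ (fun k => ((r : ℝ) : ℂ) • a k) = Φ a)
    {ν R : ℝ} {τ : (UnitAddTorus d → EuclideanSpace ℝ d) → ℝ}
    (hlaw : ∀ (u : ℝ → UnitAddTorus d → EuclideanSpace ℝ d) (p : ℝ → UnitAddTorus d → ℝ),
      Torus.IsClassicalNSSolutionOn (Ici 0) ν 0 u p → ∀ t : ℝ, 0 ≤ t → 0 ≤ t + τ (u 0) →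
        R < Ψ (u t) → Ψ (u (t + τ (u 0))) < Ψ (u t))
    {S : Finset (d → ℤ)} {c : (d → ℤ) → EuclideanSpace ℂ d}
    (hc : ∀ k ∈ S, ∀ l ∈ S, ∑ j, (l j : ℂ) * c k j = 0) :
    Ψ (realTrigPoly S c) ≤ R := by
  by_contra hR
  rw [not_le] at hR
  set t : ℝ := max (-(τ (realTrigPoly S c))) 0 with ht
  have h0 : 0 ≤ t := le_max_right _ _
  have h1 : 0 ≤ t + τ (heatFlow ν S c 0) := by
    rw [heatFlow_zero]; linarith [le_max_left (-(τ (realTrigPoly S c))) 0]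
  have h := hlaw _ _ (isClassicalNSSolutionOn_heatFlow_Ici ν hc) t h0 h1
  rw [shellShape_heatFlow_eq' hΨ hdep hhom, shellShape_heatFlow_eq' hΨ hdep hhom] at h
  exact lt_irrefl _ (h hR)

/-- **NO UNIVERSAL LOWER RELAXATION EITHER** (equipartition / «coherence builds up» claims): a law
«`C ≤ Ψ(u(t))` for all `t ≥ τ(u(0))`» along every global classical solution forces `C ≤ Ψ(w)` on every
cross-transversal trigonometric datum. [cite: MajdaBertozzi2002, §1.2] -/
theorem static_lower_bound_of_relaxation_law (hΨ : ∀ w, Ψ w = Φ (coeffs w))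
    (hdep : ∀ a b : (d → ℤ) → EuclideanSpace ℂ d, (∀ k, freqNormSq k = K → a k = b k) → Φ a = Φ b)
    (hhom : ∀ r : ℝ, 0 < r → ∀ a : (d → ℤ) → EuclideanSpace ℂ d, Φ (fun k => ((r : ℝ) : ℂ) • a k) = Φ a)
    {ν C : ℝ} {τ : (UnitAddTorus d → EuclideanSpace ℝ d) → ℝ}
    (hlaw : ∀ (u : ℝ → UnitAddTorus d → EuclideanSpace ℝ d) (p : ℝ → UnitAddTorus d → ℝ),
      Torus.IsClassicalNSSolutionOn (Ici 0) ν 0 u p → ∀ t : ℝ, τ (u 0) ≤ t → 0 ≤ t → C ≤ Ψ (u t))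
    {S : Finset (d → ℤ)} {c : (d → ℤ) → EuclideanSpace ℂ d}
    (hc : ∀ k ∈ S, ∀ l ∈ S, ∑ j, (l j : ℂ) * c k j = 0) :
    C ≤ Ψ (realTrigPoly S c) := by
  set t : ℝ := max (τ (realTrigPoly S c)) 0 with ht
  have h := hlaw _ _ (isClassicalNSSolutionOn_heatFlow_Ici ν hc) t
    (by rw [heatFlow_zero]; exact le_max_left _ _) (le_max_right _ _)
  rwa [shellShape_heatFlow_eq' hΨ hdep hhom] at h

end Barrier

/-! ## §3 A stock functional: the in-shell phase-alignment ratio (the hypotheses are not vacuous)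

For a finite set `F` of wave vectors lying on ONE shell (`|k|² = K` on `F`), the ratio
`A_F(a) = ‖Σ_{k∈F} a k‖² / Σ_{k∈F} ‖a k‖²` is `#F` for fully aligned equal coefficients, `≤ #F` always
(Cauchy–Schwarz) and small for «incoherent» phases — the shape of every «shell coherence / magnetisation»
order parameter. It satisfies (i) and (ii), so it is frozen along every heat-flow solution. -/

section Stock

/-- The in-shell phase-alignment ratio `A_F(a) = ‖Σ_{k∈F} a k‖² / Σ_{k∈F} ‖a k‖²` of coefficient data
over a finite set `F` of wave vectors (junk `0` when all coefficients on `F` vanish). [cite: Grafakos2014, §3.1.1] -/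
def alignRatio (F : Finset (d → ℤ)) (a : (d → ℤ) → EuclideanSpace ℂ d) : ℝ :=
  ‖∑ k ∈ F, a k‖ ^ 2 / ∑ k ∈ F, ‖a k‖ ^ 2

omit [DecidableEq d] in
/-- (i) `A_F` depends only on the coefficients on the shell carrying `F`. [cite: Grafakos2014, §3.1.1] -/
theorem alignRatio_dep {F : Finset (d → ℤ)} {K : ℝ} (hF : ∀ k ∈ F, freqNormSq k = K)
    (a b : (d → ℤ) → EuclideanSpace ℂ d) (hab : ∀ k, freqNormSq k = K → a k = b k) :
    alignRatio F a = alignRatio F b := by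
  unfold alignRatio
  have h1 : ∑ k ∈ F, a k = ∑ k ∈ F, b k := Finset.sum_congr rfl fun k hk => hab k (hF k hk)
  have h2 : ∑ k ∈ F, ‖a k‖ ^ 2 = ∑ k ∈ F, ‖b k‖ ^ 2 :=
    Finset.sum_congr rfl fun k hk => by rw [hab k (hF k hk)]
  rw [h1, h2]

omit [DecidableEq d] in
/-- (ii) `A_F` is invariant under multiplication by a positive real (degree `0`). [cite: Grafakos2014, §3.1.1] -/
theorem alignRatio_hom (F : Finset (d → ℤ)) (r : ℝ) (hr : 0 < r) (a : (d → ℤ) → EuclideanSpace ℂ d) :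
    alignRatio F (fun k => ((r : ℝ) : ℂ) • a k) = alignRatio F a := by
  unfold alignRatio
  have hn : ∀ k, ‖((r : ℝ) : ℂ) • a k‖ ^ 2 = r ^ 2 * ‖a k‖ ^ 2 := by
    intro k
    rw [norm_smul, Complex.norm_real, Real.norm_eq_abs, abs_of_pos hr]; ring
  simp_rw [hn]
  rw [← Finset.smul_sum, norm_smul, Complex.norm_real, Real.norm_eq_abs, abs_of_pos hr, mul_pow,
    ← Finset.mul_sum, mul_div_mul_left _ _ (pow_ne_zero 2 hr.ne')]

/-- **The in-shell alignment ratio is frozen along every heat-flow solution** — no «dephasing» of the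
modes of a shell occurs along the exact parallel-shear / columnar Navier–Stokes solutions, whatever the
initial phases. [cite: MajdaBertozzi2002, §1.2] -/
theorem alignRatio_heatFlow_eq {F : Finset (d → ℤ)} {K : ℝ} (hF : ∀ k ∈ F, freqNormSq k = K)
    (ν : ℝ) (S : Finset (d → ℤ)) (c : (d → ℤ) → EuclideanSpace ℂ d) (t : ℝ) :
    alignRatio F (coeffs (heatFlow ν S c t)) = alignRatio F (coeffs (realTrigPoly S c)) :=
  shellShape_heatFlow_eq (alignRatio_dep hF) (fun r hr a => alignRatio_hom F r hr a) ν S c t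

end Stock

end FrozenShellShape

open FrozenShellShape Literature.Analysis.FunctionSpaces Literature.Analysis.FunctionSpaces.Torus
  Literature.Analysis.FluidPDE Literature.Analysis.FluidPDE.TransversalModes

/-- **Barrier (method-level lemma): the shape of a Fourier shell is frozen along the exact heat-flow
solutions of Navier–Stokes on `𝕋³`; universal in-shell relaxation laws (dephasing, decoherence,
equipartition, contraction of an order parameter) reduce to static bounds on transversal data.**

BARRIER (structured block, D-0021):
technique_class: deterministic-dephasing phase-decoherence-for-every-solution random-phase-as-lemma shell-coherence-order-parameter relaxation-time-argument equipartition-inside-shell isotropisation-along-flow statistical-mechanics-heuristic-as-theorem degree-zero-shape-audit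
blocks: arguments for NavierStokesRegularity that bound a supercritical quantity (enstrophy production, `‖ω‖_∞`, transfer into a shell) through an in-shell PHASE / SHAPE statistic `Φ_K` claimed to relax to `O(1)` (or to contract, or to equilibrate) after a turnover time along EVERY solution, «regardless of the initial phase configuration» — the decisive display is a universal-in-data, time-asymptotic bound on a degree-`0`, single-shell functional of the Fourier coefficients
because: cross-transversal real trigonometric polynomials (`l · c_k = 0` for all `k, l ∈ S`: parallel shear and columnar flows, free phases and amplitudes) evolve under Navier–Stokes EXACTLY by the heat semigroup, for every `ν` [cite: MajdaBertozzi2002, §1.2] [cite: Pizzocchero2021, §6 (6.3), (6.6)] (`isClassicalNSSolutionOn_heatFlow`, `isGlobalLerayHopf_heatFlow`); the heat semigroup multiplies the coefficient vector of the shell `{|k|² = K}` by the single positive scalar `e^{−4π²νKt}` (`coeffs_heatFlow`), so every degree-`0` shell-determined functional is a constant of motion there (`shellShape_heatFlow_eq`); hence a universal upper / lower relaxation law gives the same bound STATICALLY on all such data (`static_bound_of_relaxation_law`, `static_lower_bound_of_relaxation_law`) and a universal strict-contraction law above a threshold `R` forces the static ceiling `≤ R` (`threshold_ge_of_contraction_law`)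 — relaxation and turnover times are idle; the hypotheses (i)–(ii) are not vacuous: the in-shell phase-alignment ratio `‖Σ_{k∈F} a_k‖²/Σ_{k∈F}‖a_k‖²` of any single-shell mode set `F` satisfies them and is frozen (`alignRatio_heatFlow_eq`)
evasions_known: (a) GENERIC-data / probabilistic formulations («for almost every phase configuration», ensemble or time averages) are not refuted — but then the per-trajectory use of the bound is the gap (T5 row; `CesaroSpectrumNoSupControl`); (b) functionals mixing SEVERAL shells (normalised spectra `E_K/E`, spectral slopes) are NOT frozen by the heat flow (different shells decay at different rates) — use `ExactModeLineDecayLaws` / `ScalingAudit` for those; (c) laws CONDITIONAL on genuinely nonlinear hypotheses excluding the shear / columnar class (non-vanishing Lamb vector, helicity bounds away from zero, three-dimensionality of the active set) evade the witness family — the hypothesis must then be carried to the end of the argument; (d) functionals that see the zero mode or the mean are outside (ii) unless normalised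
scope_caveats: (i) periodic setting `𝕋ᵈ = (ℝ/ℤ)ᵈ`, unforced, any `ν` (the solutions are exact for `ν = 0` too); (ii) laws are typed along GLOBAL CLASSICAL solutions on `[0, ∞)` — laws over Leray–Hopf solutions imply them on this class (`isGlobalLerayHopf_heatFlow` + weak–strong uniqueness) and laws over local solutions on `[0, T)` restrict (`IsClassicalNSSolutionOn.mono`); (iii) whether the static bound FAILS is functional-specific arithmetic on trigonometric data (for C135's `χ_K = N_K|m_K|²`: `χ_K = N_K` on single streamwise modes, `N_K` unbounded along `K = 25^j` — Summit-side `…Theorems.Siche2026.coherence_shearFlow`, `exists_shell_card_gt`), not part of this entry; (iv) the hypotheses (i)–(ii) on `Φ` are discharged by the user per functional (pattern: `hdep` from «defined as a sum over the shell», `hhom` from «ratio of two expressions of equal homogeneity»)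
status: established (proved here; zero fact debt)
[cite: MajdaBertozzi2002, §1.2] [cite: Pizzocchero2021, §6 (6.3), (6.6)] -/
def FrozenShellShapeNoDephasing : Prop :=
  ∀ (Ψ : (UnitAddTorus (Fin 3) → EuclideanSpace ℝ (Fin 3)) → ℝ)
    (Φ : ((Fin 3 → ℤ) → EuclideanSpace ℂ (Fin 3)) → ℝ) (K : ℝ),
    (∀ w, Ψ w = Φ (coeffs w)) →
    (∀ a b : (Fin 3 → ℤ) → EuclideanSpace ℂ (Fin 3), (∀ k, freqNormSq k = K → a k = b k) → Φ a = Φ b) →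
    (∀ r : ℝ, 0 < r → ∀ a : (Fin 3 → ℤ) → EuclideanSpace ℂ (Fin 3), Φ (fun k => ((r : ℝ) : ℂ) • a k) = Φ a) →
    ∀ (ν : ℝ) (S : Finset (Fin 3 → ℤ)) (c : (Fin 3 → ℤ) → EuclideanSpace ℂ (Fin 3)),
      (∀ k ∈ S, ∀ l ∈ S, ∑ j, (l j : ℂ) * c k j = 0) →
      -- (1) frozen along the exact solution `heatFlow ν S c` (a global classical NS solution)
      (Torus.IsClassicalNSSolutionOn (Ici 0) ν 0 (heatFlow ν S c) (fun _ _ => (0 : ℝ)) ∧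
        ∀ t : ℝ, Ψ (heatFlow ν S c t) = Ψ (realTrigPoly S c)) ∧
      -- (2) every universal relaxation law is already a static bound on the datum
      (∀ (C : ℝ) (τ : (UnitAddTorus (Fin 3) → EuclideanSpace ℝ (Fin 3)) → ℝ),
        (∀ (u : ℝ → UnitAddTorus (Fin 3) → EuclideanSpace ℝ (Fin 3)) (p : ℝ → UnitAddTorus (Fin 3) → ℝ),
          Torus.IsClassicalNSSolutionOn (Ici 0) ν 0 u p → ∀ t : ℝ, τ (u 0) ≤ t → 0 ≤ t → Ψ (u t) ≤ C) →
        Ψ (realTrigPoly S c) ≤ C) ∧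
      -- (3) every universal strict-contraction law above `R` forces the static ceiling `≤ R`
      (∀ (R : ℝ) (τ : (UnitAddTorus (Fin 3) → EuclideanSpace ℝ (Fin 3)) → ℝ),
        (∀ (u : ℝ → UnitAddTorus (Fin 3) → EuclideanSpace ℝ (Fin 3)) (p : ℝ → UnitAddTorus (Fin 3) → ℝ),
          Torus.IsClassicalNSSolutionOn (Ici 0) ν 0 u p → ∀ t : ℝ, 0 ≤ t → 0 ≤ t + τ (u 0) →
            R < Ψ (u t) → Ψ (u (t + τ (u 0))) < Ψ (u t)) →
        Ψ (realTrigPoly S c) ≤ R)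

/-- Discharge of the barrier statement. [cite: MajdaBertozzi2002, §1.2] [cite: Pizzocchero2021, §6 (6.3), (6.6)] -/
theorem frozenShellShapeNoDephasing_holds : FrozenShellShapeNoDephasing := by
  intro Ψ Φ K hΨ hdep hhom ν S c hc
  refine ⟨⟨isClassicalNSSolutionOn_heatFlow_Ici ν hc,
    fun t => shellShape_heatFlow_eq' hΨ hdep hhom ν S c t⟩, ?_, ?_⟩
  · intro C τ hlaw
    exact static_bound_of_relaxation_law hΨ hdep hhom hlaw hc
  · intro R τ hlaw
    exact threshold_ge_of_contraction_law hΨ hdep hhom hlaw hc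

/-- `FrozenShellShapeNoDephasing` — `_holds` alias of `frozenShellShapeNoDephasing_holds` above under the fact's exact name (appended
2026-08-28, D-0026 bookkeeping: the proof term is the existing theorem of this file; no statement,
definition or attribute is edited; no new named fact; the ledger's debt table listed the fact
unproved). [cite: Pizzocchero2021, §6 (6.3), (6.6)] -/
theorem _root_.Literature.Barriers.NavierStokesRegularity.FrozenShellShapeNoDephasing_holds :
    FrozenShellShapeNoDephasing :=
  _root_.Literature.Barriers.NavierStokesRegularity.frozenShellShapeNoDephasing_holds

end Literature.Barriers.NavierStokesRegularity

end

-- WHAT THIS IS NOT: not a claim about NS regularity or blow-up; not a claim about any author beyond the typed locator.
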